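import Mathlib.Analysis.Convex.Topology
import Mathlib.Analysis.SpecialFunctions.Log.Basic
import Mathlib.LinearAlgebra.Matrix.Symmetric
import Mathlib.Topology.MetricSpace.Lipschitz
import Mathlib.MeasureTheory.Constructions.BorelSpace.Basic
import Literature.MathematicalPhysics.QuantumFieldTheory.Balaban1983to89.T4ShellMeasure

/-!
# N21 (NE7c) · quadratic domination about a centre with OBTUSE cross terms, and the A-PROJECTED centre (lens Cards 84–85 ∕ ROW P‴)

R134 seat pub-ymgap-dag-n21-d (g8), node N21 = NE7c (single-run shell-weight bound, NOT PRINTED in [Bałaban 1983–89],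
NOT proved), lane K3⁷ `SpineGivenEndpointR13SepCoPH` (stmt-QuantumFields-20544, `--kind proof --supports … --as helper`).
Part 32 of the comparison series.  THIS FILE = §A + §B of the lens's `Sketch-nearmiss-g29.lean` (LENS-nearmiss v29.0 ROW P‴; first refusal dag-n21-d) — farm rc 0 · 0 warnings at the
lens desk — VERBATIM, statements and proofs, re-homed in this namespace.  AUTHORSHIP OF THE MATHEMATICS: planner seat
`ym-lens-BalabanUVNodes-nearmiss` g29 (memo-only seat, cannot file); this seat only files.  §C (Card 86, Agmon ∕ Caccioppoli for the box
obstacle problem) lands as part 33 `…N21BoxObstacleDecay`; the corollary (G28 P2 with `hmono` discharged by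
`hmono_of_projectedCentre`) as part 34 `…N21ProjectedCentreDilation` (400-line rule).

WHAT (lens, state W²⁷: the linear centre misses the kept polytope only by a PROJECTION).  §A (Cards 84+85) QUADRATIC
DOMINATION ABOUT ANY CENTRE WITH AN OBTUSE CROSS TERM: for `φ = ½⟨·−m, A(·−m)⟩ + P` (`A` symmetric, `γ‖x‖² ≤ ⟨x,Ax⟩`,
`P` merely `G`-Lipschitz on the kept convex set `K` — NO convexity of `φ` or `P`), a centre `c ∈ K` and `w ∈ K` with
`⟨c − m, A(w − c)⟩ ≥ 0`: `φ(c + l(w−c)) ≤ φ(w)` for every `l ∈ [0,1]` once `γ‖w − c‖ ≥ 2G` (`chordMono_of_obtuse`); P2's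
`hmono` binder verbatim: `hmono_of_projectedCentre` (REPLACES part 30's `hφ : ConvexOn` on the main road).  §B (Card 85)
THE A-PROJECTED CENTRE: the obtuse angle IS the variational inequality of the minimiser of `½⟨·−m, A(·−m)⟩` over the
CLOSED kept polytope (`obtuse_of_isMinOn`); it keeps every block letter; `= m` when `m ∈ K̄`; `Γ∕γ`-Lipschitz ⇒
measurable with no selection theorem (`measurable_projectedCentre`).  Part 29 `keptCut_noExit`, part 30
`measurable_linearCentre`, part 28 P2 are the neighbours by name (not imported).

HONEST FRAMING.  [textbook] linear algebra ∕ convexity ∕ measurability; 0 def, 0 sorry; nothing of Bałaban's asserted; NE7c NOT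
PRINTED ∕ NOT proved; N21 NOT discharged; counts unmoved (typed 28∕28 · discharged 5∕27); count-neutral; one finite 𝕋⁴ at
fixed ε — nothing about ℝ⁴ ∕ OS ∕ mass gap ∕ Clay.
-/

open Set Matrix

namespace Summit.QuantumFields.YangMills.Theorems.N21ProjectedCentreNonCollapse

/-! ## §A  Cards 84 + 85 — quadratic domination about any centre with an obtuse cross term (no convexity of `φ`) -/

section Domination

variable {κ : Type*} [Fintype κ]

/-- Symmetric form swap. [textbook] -/
theorem dotMulVec_symm_swap (A : Matrix κ κ ℝ) (hA : A.IsSymm) (x y : κ → ℝ) :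
    x ⬝ᵥ (A *ᵥ y) = y ⬝ᵥ (A *ᵥ x) := by
  rw [Matrix.dotProduct_mulVec, ← Matrix.mulVec_transpose, hA.eq, dotProduct_comm]

/-- **GAP IDENTITY ABOUT AN ARBITRARY CENTRE.**  `q v := ½⟨v − m, A(v − m)⟩`, centre `c`, point `w`, `u := w − c`,
`e := c − m`: `q w − q (c + l•u) = (1 − l)·[(1+l)∕2·⟨u,Au⟩ + ⟨e,Au⟩]`.  For `c = m` (Card 81∕82: `e = 0`) this is
the `(1 − l²)` identity; the cross term `⟨e,Au⟩` is what a non-minimising centre costs. [textbook] -/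
theorem quadGap_about_centre (A : Matrix κ κ ℝ) (hA : A.IsSymm) (m c w : κ → ℝ) (l : ℝ) :
    1 / 2 * ((w - m) ⬝ᵥ (A *ᵥ (w - m)))
      - 1 / 2 * ((c + l • (w - c) - m) ⬝ᵥ (A *ᵥ (c + l • (w - c) - m)))
      = (1 - l) * ((1 + l) / 2 * ((w - c) ⬝ᵥ (A *ᵥ (w - c))) + (c - m) ⬝ᵥ (A *ᵥ (w - c))) := by
  have h1 : w - m = (c - m) + (w - c) := by abel
  have h2 : c + l • (w - c) - m = (c - m) + l • (w - c) := by abel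
  rw [h2, h1]
  simp only [Matrix.mulVec_add, Matrix.mulVec_smul, dotProduct_add, add_dotProduct, dotProduct_smul,
    smul_dotProduct, smul_eq_mul]
  rw [dotMulVec_symm_swap A hA (w - c) (c - m)]
  ring

/-- **CHORD MONOTONICITY FROM AN OBTUSE CROSS TERM — no convexity of `φ` or of `P`.**  `φ := ½⟨·−m,A(·−m)⟩ + P` with
`A` symmetric, `0 < γ`, `γ‖x‖² ≤ ⟨x,Ax⟩` (any norm), `P` `G`-Lipschitz on the convex kept set `K`, `c, w ∈ K`,
`⟨c − m, A(w − c)⟩ ≥ 0` and `γ‖w − c‖ ≥ 2G`: then `φ (c + l•(w − c)) ≤ φ w` for every `l ∈ [0,1]`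
(gain `(1−l)(1+l)γ∕2‖u‖²` against loss `(1−l)G‖u‖`).  [textbook; = part 20 `radialMono_of_quadratic_dominates` in the
recentred frame `u ↦ c + u`] -/
theorem chordMono_of_obtuse (A : Matrix κ κ ℝ) (hA : A.IsSymm) {γ G : ℝ} (hγ0 : 0 < γ)
    (hγ : ∀ x : κ → ℝ, γ * ‖x‖ ^ 2 ≤ x ⬝ᵥ (A *ᵥ x)) (P : (κ → ℝ) → ℝ) {K : Set (κ → ℝ)} (hK : Convex ℝ K)
    (hP : ∀ v ∈ K, ∀ v' ∈ K, P v - P v' ≤ G * ‖v - v'‖) (m c w : κ → ℝ) (hc : c ∈ K) (hw : w ∈ K)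
    (hobt : 0 ≤ (c - m) ⬝ᵥ (A *ᵥ (w - c))) (hfar : 2 * G ≤ γ * ‖w - c‖) {l : ℝ} (hl : l ∈ Icc (0 : ℝ) 1) :
    1 / 2 * ((c + l • (w - c) - m) ⬝ᵥ (A *ᵥ (c + l • (w - c) - m))) + P (c + l • (w - c))
      ≤ 1 / 2 * ((w - m) ⬝ᵥ (A *ᵥ (w - m))) + P w := by
  have hid := quadGap_about_centre A hA m c w l
  have hpl : c + l • (w - c) ∈ K := hK.add_smul_sub_mem hc hw hl
  have hPd : P (c + l • (w - c)) - P w ≤ G * ‖c + l • (w - c) - w‖ := hP _ hpl _ hw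
  have hnorm : ‖c + l • (w - c) - w‖ = (1 - l) * ‖w - c‖ := by
    have : c + l • (w - c) - w = (1 - l) • (c - w) := by
      simp only [sub_smul, one_smul, smul_sub]; abel
    rw [this, norm_smul, Real.norm_eq_abs, abs_of_nonneg (show (0 : ℝ) ≤ 1 - l by linarith [hl.2]),
      norm_sub_rev]
  rw [hnorm] at hPd
  have hq := hγ (w - c)
  have h1l : (0 : ℝ) ≤ 1 - l := by linarith [hl.2]
  have hl0 : (0 : ℝ) ≤ l := hl.1
  have hnu : 0 ≤ ‖w - c‖ := norm_nonneg _
  have hGn : G * ‖w - c‖ ≤ γ / 2 * ‖w - c‖ ^ 2 := by nlinarith [hfar, hnu]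
  have hlq : γ / 2 * ‖w - c‖ ^ 2 ≤ (1 + l) / 2 * (γ * ‖w - c‖ ^ 2) := by
    nlinarith [mul_nonneg (mul_nonneg hl0 hγ0.le) (sq_nonneg ‖w - c‖)]
  have hlu : (1 + l) / 2 * (γ * ‖w - c‖ ^ 2) ≤ (1 + l) / 2 * ((w - c) ⬝ᵥ (A *ᵥ (w - c))) :=
    mul_le_mul_of_nonneg_left hq (by linarith)
  have hkey : (1 - l) * (G * ‖w - c‖)
      ≤ (1 - l) * ((1 + l) / 2 * ((w - c) ⬝ᵥ (A *ᵥ (w - c))) + (c - m) ⬝ᵥ (A *ᵥ (w - c))) :=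
    mul_le_mul_of_nonneg_left (by linarith) h1l
  have hPd' : P (c + l • (w - c)) - P w ≤ (1 - l) * (G * ‖w - c‖) := by
    calc P (c + l • (w - c)) - P w ≤ G * ((1 - l) * ‖w - c‖) := hPd
      _ = (1 - l) * (G * ‖w - c‖) := by ring
  linarith

/-- **THE P2 BINDER `hmono`, VERBATIM, ABOUT A CENTRE WITH OBTUSE CROSS TERMS.**  Product frame `X × (κ → ℝ)` of
parts 27–28 (exterior point `z = p.1`, block chart `w = p.2`); density `g p = 𝟙_{K z}(w)·e^{−φ_z(w)}` with
`φ_z = ½⟨·−m z, A(·−m z)⟩ + P z` (the block action up to a `z`-constant absorbed in `P z`: `m z` = the linear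
Gaussian centre, `A = (C*Δ_kC)_{ΛΛ}` is `z`-free), kept CLOSED convex cuts `K z` (the boundary is Lebesgue-null, so the
cut law is unchanged), a centre `c z ∈ K z` whose cross terms are obtuse at the shell ∩ cut points and which the shell
stays `2G∕γ`-far from: then part 28's `hmono` holds for every `l ∈ [l₀,1]`, any `0 ≤ l₀`. [textbook] -/
theorem hmono_of_projectedCentre {X : Type*} (K : X → Set (κ → ℝ)) (A : Matrix κ κ ℝ) (hA : A.IsSymm)
    {γ G : ℝ} (hγ0 : 0 < γ) (hγ : ∀ x : κ → ℝ, γ * ‖x‖ ^ 2 ≤ x ⬝ᵥ (A *ᵥ x))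
    (m c : X → (κ → ℝ)) (P : X → (κ → ℝ) → ℝ) (U : X × (κ → ℝ) → ℝ) (C : Set (X × (κ → ℝ)))
    {θ ρ l₀ : ℝ} (hl₀ : 0 ≤ l₀) (hK : ∀ z, Convex ℝ (K z)) (hcK : ∀ z, c z ∈ K z)
    (hP : ∀ z, ∀ v ∈ K z, ∀ v' ∈ K z, P z v - P z v' ≤ G * ‖v - v'‖)
    (hobt : ∀ p : X × (κ → ℝ), θ * (1 - ρ) ≤ U p → U p < θ → p ∈ C → p.2 ∈ K p.1 →
      0 ≤ (c p.1 - m p.1) ⬝ᵥ (A *ᵥ (p.2 - c p.1)))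
    (hfar : ∀ p : X × (κ → ℝ), θ * (1 - ρ) ≤ U p → U p < θ → p ∈ C → p.2 ∈ K p.1 →
      2 * G ≤ γ * ‖p.2 - c p.1‖) :
    ∀ l ∈ Icc l₀ 1, ∀ p : X × (κ → ℝ), θ * (1 - ρ) ≤ U p → U p < θ → p ∈ C →
      (K p.1).indicator (fun w => ENNReal.ofReal (Real.exp
          (-(1 / 2 * ((w - m p.1) ⬝ᵥ (A *ᵥ (w - m p.1))) + P p.1 w)))) p.2
        ≤ (K p.1).indicator (fun w => ENNReal.ofReal (Real.exp
          (-(1 / 2 * ((w - m p.1) ⬝ᵥ (A *ᵥ (w - m p.1))) + P p.1 w)))) (c p.1 + l • (p.2 - c p.1)) := by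
  intro l hl p h1 h2 h3
  by_cases hw : p.2 ∈ K p.1
  · have hl' : l ∈ Icc (0 : ℝ) 1 := ⟨hl₀.trans hl.1, hl.2⟩
    have hin : c p.1 + l • (p.2 - c p.1) ∈ K p.1 := (hK p.1).add_smul_sub_mem (hcK p.1) hw hl'
    rw [indicator_of_mem hw, indicator_of_mem hin]
    refine ENNReal.ofReal_le_ofReal (Real.exp_le_exp.2 (neg_le_neg ?_))
    exact chordMono_of_obtuse A hA hγ0 hγ (P p.1) (hK p.1) (hP p.1) (m p.1) (c p.1) p.2 (hcK p.1) hw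
      (hobt p h1 h2 h3 hw) (hfar p h1 h2 h3 hw) hl'
  · rw [indicator_of_notMem hw]
    exact bot_le

end Domination

/-! ## §B  Card 85 — the A-projected centre: obtuse angle = variational inequality; identity on `K̄`; Lipschitz ⇒ measurable -/

section Projection

variable {κ : Type*} [Fintype κ]

/-- **OBTUSE ANGLE AT THE CONSTRAINED MINIMISER (variational inequality).**  If `c ∈ K` minimises
`v ↦ ⟨v − m, A(v − m)⟩` over the convex set `K` (`A` symmetric), then `⟨c − m, A(w − c)⟩ ≥ 0` for every `w ∈ K`
— the hypothesis `hobt` of `chordMono_of_obtuse` ∕ `hmono_of_projectedCentre`.  (First variation along the segment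
`c + t(w − c) ⊆ K`, `t ↓ 0`.) [textbook: Hiriart-Urruty–Lemaréchal, projection onto closed convex sets] -/
theorem obtuse_of_isMinOn (A : Matrix κ κ ℝ) (hA : A.IsSymm) {K : Set (κ → ℝ)} (hK : Convex ℝ K)
    (m c : κ → ℝ) (hc : c ∈ K)
    (hmin : ∀ v ∈ K, (c - m) ⬝ᵥ (A *ᵥ (c - m)) ≤ (v - m) ⬝ᵥ (A *ᵥ (v - m)))
    (w : κ → ℝ) (hw : w ∈ K) : 0 ≤ (c - m) ⬝ᵥ (A *ᵥ (w - c)) := by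
  have hexp : ∀ t : ℝ, (c + t • (w - c) - m) ⬝ᵥ (A *ᵥ (c + t • (w - c) - m))
      = (c - m) ⬝ᵥ (A *ᵥ (c - m)) + 2 * t * ((c - m) ⬝ᵥ (A *ᵥ (w - c)))
        + t ^ 2 * ((w - c) ⬝ᵥ (A *ᵥ (w - c))) := by
    intro t
    have : c + t • (w - c) - m = (c - m) + t • (w - c) := by abel
    rw [this]
    simp only [Matrix.mulVec_add, Matrix.mulVec_smul, dotProduct_add, add_dotProduct, dotProduct_smul,
      smul_dotProduct, smul_eq_mul]
    rw [dotMulVec_symm_swap A hA (w - c) (c - m)]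
    ring
  have hineq : ∀ t ∈ Icc (0 : ℝ) 1,
      0 ≤ 2 * t * ((c - m) ⬝ᵥ (A *ᵥ (w - c))) + t ^ 2 * ((w - c) ⬝ᵥ (A *ᵥ (w - c))) := by
    intro t ht
    have hmem : c + t • (w - c) ∈ K := hK.add_smul_sub_mem hc hw ht
    have h := hmin _ hmem
    rw [hexp t] at h
    linarith
  set a := (c - m) ⬝ᵥ (A *ᵥ (w - c)) with ha
  set b := (w - c) ⬝ᵥ (A *ᵥ (w - c)) with hb
  by_contra hneg
  rw [not_le] at hneg
  by_cases hb0 : b ≤ 0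
  · have h := hineq 1 ⟨zero_le_one, le_rfl⟩
    nlinarith
  · rw [not_le] at hb0
    have ht0 : 0 < -a / b := div_pos (by linarith) hb0
    set t := min 1 (-a / b) with ht
    have htpos : 0 < t := lt_min zero_lt_one ht0
    have ht1 : t ≤ 1 := min_le_left _ _
    have htle : t ≤ -a / b := min_le_right _ _
    have htb : t * b ≤ -a := by
      have h := mul_le_mul_of_nonneg_right htle hb0.le
      rwa [div_mul_cancel₀ _ hb0.ne'] at h
    have h := hineq t ⟨htpos.le, ht1⟩
    nlinarith [mul_le_mul_of_nonneg_left htb htpos.le, mul_pos htpos (neg_pos.2 hneg)]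

/-- **THE PROJECTED CENTRE IS THE LINEAR CENTRE WHENEVER THE LATTER KEEPS THE LETTERS.**  If `m ∈ K` itself and the
cross terms about `c` are obtuse on `K` (`γ`-coercive `A`), then `c = m`: Card 85 changes nothing on the exterior
configurations for which Card 82's centre already sits in the kept polytope. [textbook] -/
theorem projectedCentre_eq_of_mem (A : Matrix κ κ ℝ) {γ : ℝ} (hγ0 : 0 < γ)
    (hγ : ∀ x : κ → ℝ, γ * ‖x‖ ^ 2 ≤ x ⬝ᵥ (A *ᵥ x)) {K : Set (κ → ℝ)} (m c : κ → ℝ) (hm : m ∈ K)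
    (hobt : ∀ w ∈ K, 0 ≤ (c - m) ⬝ᵥ (A *ᵥ (w - c))) : c = m := by
  have h := hobt m hm
  have h2 : (c - m) ⬝ᵥ (A *ᵥ (m - c)) = -((c - m) ⬝ᵥ (A *ᵥ (c - m))) := by
    rw [show m - c = -(c - m) by abel, Matrix.mulVec_neg, dotProduct_neg]
  rw [h2] at h
  have h3 := hγ (c - m)
  have h4 : ‖c - m‖ ^ 2 ≤ 0 := by nlinarith
  have h5 : ‖c - m‖ ^ 2 = 0 := le_antisymm h4 (sq_nonneg _)
  exact sub_eq_zero.1 (norm_eq_zero.1 ((pow_eq_zero_iff two_ne_zero).1 h5))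

/-- **THE `A`-METRIC PROJECTION IS `Γ∕γ`-LIPSCHITZ.**  A map `Pr` into `K` with obtuse cross terms
(`⟨Pr v − v, A(w − Pr v)⟩ ≥ 0` on `K`) for a `γ`-coercive, `Γ`-bounded symmetric form satisfies
`‖Pr v − Pr v'‖ ≤ (Γ∕γ)‖v − v'‖` (add the two variational inequalities). [textbook] -/
theorem dist_proj_le_of_obtuse (A : Matrix κ κ ℝ) {γ Γ : ℝ} (hγ0 : 0 < γ)
    (hγ : ∀ x : κ → ℝ, γ * ‖x‖ ^ 2 ≤ x ⬝ᵥ (A *ᵥ x))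
    (hΓ : ∀ x y : κ → ℝ, x ⬝ᵥ (A *ᵥ y) ≤ Γ * ‖x‖ * ‖y‖)
    {K : Set (κ → ℝ)} (Pr : (κ → ℝ) → (κ → ℝ)) (hPrK : ∀ v, Pr v ∈ K)
    (hobt : ∀ v, ∀ w ∈ K, 0 ≤ (Pr v - v) ⬝ᵥ (A *ᵥ (w - Pr v))) (v v' : κ → ℝ) :
    ‖Pr v - Pr v'‖ ≤ Γ / γ * ‖v - v'‖ := by
  have h1 := hobt v (Pr v') (hPrK v')
  have h2 := hobt v' (Pr v) (hPrK v)
  have e2 : (Pr v - v) ⬝ᵥ (A *ᵥ (Pr v' - Pr v)) + (Pr v' - v') ⬝ᵥ (A *ᵥ (Pr v - Pr v'))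
      = (v - v') ⬝ᵥ (A *ᵥ (Pr v - Pr v')) - (Pr v - Pr v') ⬝ᵥ (A *ᵥ (Pr v - Pr v')) := by
    have ea : Pr v' - Pr v = -(Pr v - Pr v') := by abel
    have eb : Pr v' - v' = (Pr v - v) - (Pr v - Pr v') + (v - v') := by abel
    rw [ea, eb, Matrix.mulVec_neg, dotProduct_neg]
    simp only [sub_dotProduct, add_dotProduct]
    ring
  have hsum : 0 ≤ (v - v') ⬝ᵥ (A *ᵥ (Pr v - Pr v')) - (Pr v - Pr v') ⬝ᵥ (A *ᵥ (Pr v - Pr v')) := by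
    have h := add_nonneg h1 h2
    rwa [e2] at h
  have h3 := hγ (Pr v - Pr v')
  have h4 := hΓ (v - v') (Pr v - Pr v')
  have h5 : γ * ‖Pr v - Pr v'‖ ^ 2 ≤ Γ * ‖v - v'‖ * ‖Pr v - Pr v'‖ := by linarith
  by_cases hd : ‖Pr v - Pr v'‖ = 0
  · rw [hd]
    by_cases hs : ‖v - v'‖ = 0
    · rw [hs]; simp
    · have hspos : 0 < ‖v - v'‖ := lt_of_le_of_ne (norm_nonneg _) (Ne.symm hs)
      have hΓ0 : 0 ≤ Γ := by
        have h6 := hΓ (v - v') (v - v')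
        have h7 := hγ (v - v')
        have h8 : 0 < ‖v - v'‖ ^ 2 := by positivity
        by_contra hΓneg
        rw [not_le] at hΓneg
        nlinarith [mul_pos hγ0 h8, mul_neg_of_neg_of_pos hΓneg h8]
      positivity
  · have hdpos : 0 < ‖Pr v - Pr v'‖ := lt_of_le_of_ne (norm_nonneg _) (Ne.symm hd)
    rw [div_mul_eq_mul_div, le_div_iff₀ hγ0]
    nlinarith [h5, hdpos]

/-- Packaging: the projection is `LipschitzWith (Γ∕γ)⁺`. [textbook] -/
theorem lipschitzWith_proj_of_obtuse (A : Matrix κ κ ℝ) {γ Γ : ℝ} (hγ0 : 0 < γ)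
    (hγ : ∀ x : κ → ℝ, γ * ‖x‖ ^ 2 ≤ x ⬝ᵥ (A *ᵥ x))
    (hΓ : ∀ x y : κ → ℝ, x ⬝ᵥ (A *ᵥ y) ≤ Γ * ‖x‖ * ‖y‖)
    {K : Set (κ → ℝ)} (Pr : (κ → ℝ) → (κ → ℝ)) (hPrK : ∀ v, Pr v ∈ K)
    (hobt : ∀ v, ∀ w ∈ K, 0 ≤ (Pr v - v) ⬝ᵥ (A *ᵥ (w - Pr v))) :
    LipschitzWith (Real.toNNReal (Γ / γ)) Pr :=
  LipschitzWith.of_dist_le_mul fun v v' => by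
    rw [dist_eq_norm, dist_eq_norm, Real.coe_toNNReal']
    exact (dist_proj_le_of_obtuse A hγ0 hγ hΓ Pr hPrK hobt v v').trans
      (mul_le_mul_of_nonneg_right (le_max_left _ _) (norm_nonneg _))

/-- **THE PROJECTED CENTRE IS MEASURABLE (no selection theorem).**  `z ↦ Pr (m z)` for a Lipschitz projection and a
measurable (e.g. linear: v28.0 `measurable_linearCentre`) centre. [textbook] -/
theorem measurable_projectedCentre {X : Type*} [MeasurableSpace X] (Pr : (κ → ℝ) → (κ → ℝ)) {L : NNReal}
    (hPr : LipschitzWith L Pr) {m : X → (κ → ℝ)} (hm : Measurable m) :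
    Measurable (fun z => Pr (m z)) :=
  hPr.continuous.measurable.comp hm

end Projection

end Summit.QuantumFields.YangMills.Theorems.N21ProjectedCentreNonCollapse
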